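import Summits.RiemannHypothesis.RiemannHypothesis.Theorems.MotivicDoorDeningerHodgePackage
import Summits.RiemannHypothesis.RiemannHypothesis.Theorems.MotivicDoorDeningerRealTwist
import Summits.RiemannHypothesis.RiemannHypothesis.Theorems.SoloInformedWeilSurface

/-!
# One located gap, two carriers — the two typed interfaces carry the same information (motivic door, cc-4 gen 4)

The motivic-door autopsy (HOME/LOCATED-GAP.md, ruling G11 "one located gap, two carriers") types the
object the Connes–Consani programme lacks for Weil positivity on TWO carriers:

* SURFACE carrier (cc-3; Weil 1948 / Mattuck–Tate / Grothendieck; Connes–Consani's Riemann–Roch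
  strategy arXiv:1805.10501 §3): a `WeilSurface` (`Theorems/SoloInformedWeilSurface.lean`) — divisor
  classes with an intersection form, two rulings, graphs `corr g` whose intersection numbers are the
  explicit formula, and Riemann–Roch + vanishing inequalities for a real-valued `h0`;
  `riemannHypothesis_iff_nonempty_weilSurface` (T53).
* CURVE carrier (cc-4; Serre 1960 / Rosati / Deninger arXiv:2204.02714 §2): a Hodge package
  `(θ, C, ∗, B)` — Deninger's (2.3) `SpectrumAxiom`, (2.5) `CupLeibniz`, (2.6) `CupPerfect`, (2.7)
  `HodgeStar` (`Literature/NumberTheory/Deninger2022/ArithmeticCohomology.lean`), or its weakest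
  RH-relevant form `ZerosAreEigenvalues θ ∧ Polarized θ B`;
  `DeningerHodgePackage.riemannHypothesis_iff_exists_hodgePackage`,
  `DeningerSpectrumModel.riemannHypothesis_iff_exists_polarized` (T0), and the real-structure reading
  `DeningerRealTwist.posDef_realForm_iff_riemannHypothesis` (positivity of the ONE canonical
  `θ`-compatible form `B_τ` on the zero-multiset carrier).

This file records, as kernel theorems, the sentence the paper prints next to G11: **as typed
interfaces the two located objects are equivalent to each other, to Weil positivity
(`WeilPositivity`, Weil 1952 / Bombieri 2000 Thm 2, `weil_criterion_holds`) and to RH**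
(`located_objects_tfae`), with the two "functorial" directions valid for ARBITRARY carriers
(`nonempty_weilSurface_of_polarized`: any complex carrier with zeros-as-eigenvalues and a
polarization yields a Weil surface over `ℝ³`; `exists_hodgePackage_of_weilSurface`: a Weil surface over
any real vector space of classes yields Deninger's complete package on the multiplicity carrier).
Every equivalence passes through `RiemannHypothesis` (Serre's argument / Castelnuovo–Severi in one
direction, the RH-models in the other): the interfaces carry NO arithmetic, and the whole content of
either programme is the CONSTRUCTION of the carrier from a geometry of `Spec ℤ̄` without input from
the zeros (LOCATED-GAP tests G1–G7 / T0–T5).  This is why the cell never presents an axiom list as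
progress.

Honest grade: bookkeeping (compositions of landed theorems), PROVED in the kernel; nothing about `ζ`
beyond Weil's criterion; RH probability unchanged (negligible).  HONEST FRAMING: lottery ticket at the
motivic door; RH probability negligible; consolation prizes are real: a new semi-local Weil-positivity
theorem, or a located gap in the Connes–Consani programme, plus the ff-door theorem.
References: A. Weil (1952); E. Bombieri, *Problems of the Millennium: the Riemann Hypothesis* (2000)
Thm 2; A. Connes, C. Consani, arXiv:1805.10501 §3; C. Deninger, arXiv:2204.02714 §2 (2.3)–(2.7);
J.-P. Serre, Ann. of Math. 71 (1960) 392–394.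
-/

set_option linter.dupNamespace false

noncomputable section

open Complex Module Module.End
open Literature.NumberTheory.LFunctions Literature.NumberTheory.Deninger2022
open Summit.RiemannHypothesis.RiemannHypothesis.Theorems
open Summit.RiemannHypothesis.RiemannHypothesis.Theorems.MotivicDoor.DeningerSpectrumModel
open Summit.RiemannHypothesis.RiemannHypothesis.Theorems.MotivicDoor.DeningerHodgeTwist
open Summit.RiemannHypothesis.RiemannHypothesis.Theorems.MotivicDoor.DeningerPartner
open Summit.RiemannHypothesis.RiemannHypothesis.Theorems.MotivicDoor.DeningerHodgePackage
open Summit.RiemannHypothesis.RiemannHypothesis.Theorems.MotivicDoor.DeningerRealTwist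

namespace Summit.RiemannHypothesis.RiemannHypothesis.Theorems.MotivicDoor.TwoCarriers

variable {H : Type*} [AddCommGroup H] [Module ℂ H]

/-- **Curve ⇒ surface, for an arbitrary carrier.** A complex vector space `H` with an endomorphism
having every non-trivial zero of `ζ` as an eigenvalue and a polarization (Deninger (2.3)⁻ ∧ (2.5) ∧
(2.7′)) yields a Weil surface over `ℝ³` — through Serre's argument
(`riemannHypothesis_of_zerosAreEigenvalues_of_polarized`) and the RH-model `WeilSurface.model`. -/
theorem nonempty_weilSurface_of_polarized {θ : End ℂ H} {B : H →ₗ[ℂ] H →ₗ⋆[ℂ] ℂ}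
    (h23 : ZerosAreEigenvalues θ) (hP : Polarized θ B) : Nonempty (WeilSurface (ℝ × ℝ × ℝ)) :=
  ⟨WeilSurface.model (riemannHypothesis_of_zerosAreEigenvalues_of_polarized h23 hP)⟩

/-- **Curve ⇒ surface, complete list.** Deninger's complete package on any carrier yields a Weil surface
over `ℝ³`. -/
theorem nonempty_weilSurface_of_hodgeStar {θ : End ℂ H} {C : H →ₗ[ℂ] H →ₗ[ℂ] ℂ}
    {star : H →ₗ⋆[ℂ] H} {B : H →ₗ[ℂ] H →ₗ⋆[ℂ] ℂ} (h23 : SpectrumAxiom θ) (h25 : CupLeibniz θ C)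
    (h27 : HodgeStar θ C star B) : Nonempty (WeilSurface (ℝ × ℝ × ℝ)) :=
  ⟨WeilSurface.model (riemannHypothesis_of_spectrum_of_polarized h23 (polarized_of_hodgeStar h25 h27))⟩

/-- **Surface ⇒ curve, for an arbitrary space of classes.** A Weil surface over any real vector space
of divisor classes yields Deninger's complete package `(θ, C, ∗, B)` on the multiplicity carrier —
through Castelnuovo–Severi ⇒ Weil positivity ⇒ RH (`WeilSurface.riemannHypothesis`) and the signed
partner twist of the spectrum model (`package_of_rh`). -/
theorem exists_hodgePackage_of_weilSurface {V : Type*} [AddCommGroup V] [Module ℝ V]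
    (X : WeilSurface V) :
      ∃ (θ : End ℂ (MIndex →₀ ℂ)) (C : (MIndex →₀ ℂ) →ₗ[ℂ] (MIndex →₀ ℂ) →ₗ[ℂ] ℂ)
      (star : (MIndex →₀ ℂ) →ₗ⋆[ℂ] (MIndex →₀ ℂ)) (B : (MIndex →₀ ℂ) →ₗ[ℂ] (MIndex →₀ ℂ) →ₗ⋆[ℂ] ℂ),
      SpectrumAxiom θ ∧ CupLeibniz θ C ∧ CupPerfect θ C ∧ HodgeStar θ C star B :=
  ⟨diag weight, cup partner sgn, hodge partner sgn, form partner sgn, package_of_rh X.riemannHypothesis⟩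

/-- **The located objects, all typed avatars at once.** The following are equivalent:
(1) the Riemann Hypothesis; (2) Weil positivity `∀ g, 0 ≤ Re W(g ⋆ g̃)` (Weil's criterion);
(3) a Weil surface over `ℝ³` exists (surface carrier, cc-3 / T53); (4) Deninger's complete typed list
(2.3) ∧ (2.5) ∧ (2.6) ∧ (2.7) is realised on the multiplicity carrier (curve carrier, cc-4);
(5) its weakest form — zeros-as-eigenvalues plus a polarization — is realised there (T0);
(6) the ONE canonical `θ`-compatible Hermitian form of the real-structure twist,
`B_τ(f,g) = Σ_k f(k)·conj g(1 - conj ρ_k)`, is positive definite.  All six carry the same information;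
the content of the Connes–Consani and Deninger programmes is the construction of (3) or (4) from a
geometry of `Spec ℤ̄` with no input from the zeros. -/
theorem located_objects_tfae :
    List.TFAE [RiemannHypothesis, WeilPositivity, Nonempty (WeilSurface (ℝ × ℝ × ℝ)),
      (∃ (θ : End ℂ (MIndex →₀ ℂ)) (C : (MIndex →₀ ℂ) →ₗ[ℂ] (MIndex →₀ ℂ) →ₗ[ℂ] ℂ)
        (star : (MIndex →₀ ℂ) →ₗ⋆[ℂ] (MIndex →₀ ℂ)) (B : (MIndex →₀ ℂ) →ₗ[ℂ] (MIndex →₀ ℂ) →ₗ⋆[ℂ] ℂ),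
        SpectrumAxiom θ ∧ CupLeibniz θ C ∧ CupPerfect θ C ∧ HodgeStar θ C star B),
      (∃ (θ : End ℂ (MIndex →₀ ℂ)) (B : (MIndex →₀ ℂ) →ₗ[ℂ] (MIndex →₀ ℂ) →ₗ⋆[ℂ] ℂ),
        ZerosAreEigenvalues θ ∧ Polarized θ B),
      PosDef (mform partner sgn conjIdx sgn)] := by
  tfae_have 1 ↔ 2 := (weil_criterion_holds : RiemannHypothesis ↔ WeilPositivity)
  tfae_have 1 ↔ 3 := riemannHypothesis_iff_nonempty_weilSurface
  tfae_have 1 ↔ 4 := riemannHypothesis_iff_exists_hodgePackage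
  tfae_have 1 ↔ 5 := riemannHypothesis_iff_exists_polarized
  tfae_have 1 ↔ 6 := posDef_realForm_iff_riemannHypothesis.symm
  tfae_finish

/-- One gap, two carriers (G11) in one line: a Weil surface over `ℝ³` exists iff Deninger's complete
package exists on the multiplicity carrier. -/
theorem nonempty_weilSurface_iff_exists_hodgePackage :
    Nonempty (WeilSurface (ℝ × ℝ × ℝ)) ↔
      (∃ (θ : End ℂ (MIndex →₀ ℂ)) (C : (MIndex →₀ ℂ) →ₗ[ℂ] (MIndex →₀ ℂ) →ₗ[ℂ] ℂ)
        (star : (MIndex →₀ ℂ) →ₗ⋆[ℂ] (MIndex →₀ ℂ)) (B : (MIndex →₀ ℂ) →ₗ[ℂ] (MIndex →₀ ℂ) →ₗ⋆[ℂ] ℂ),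
        SpectrumAxiom θ ∧ CupLeibniz θ C ∧ CupPerfect θ C ∧ HodgeStar θ C star B) :=
  located_objects_tfae.out 2 3

/-- The surface-side interface is equivalent to Weil positivity. -/
theorem nonempty_weilSurface_iff_weilPositivity :
    Nonempty (WeilSurface (ℝ × ℝ × ℝ)) ↔ WeilPositivity :=
  located_objects_tfae.out 2 1

/-- The curve-side interface (complete list) is equivalent to Weil positivity — the needed inequality
in Deninger's template IS Weil's (classification (a) of the autopsy). -/
theorem exists_hodgePackage_iff_weilPositivity :
    (∃ (θ : End ℂ (MIndex →₀ ℂ)) (C : (MIndex →₀ ℂ) →ₗ[ℂ] (MIndex →₀ ℂ) →ₗ[ℂ] ℂ)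
        (star : (MIndex →₀ ℂ) →ₗ⋆[ℂ] (MIndex →₀ ℂ)) (B : (MIndex →₀ ℂ) →ₗ[ℂ] (MIndex →₀ ℂ) →ₗ⋆[ℂ] ℂ),
        SpectrumAxiom θ ∧ CupLeibniz θ C ∧ CupPerfect θ C ∧ HodgeStar θ C star B) ↔
      WeilPositivity :=
  located_objects_tfae.out 3 1

/-- The weakest curve-side interface is equivalent to Weil positivity (the packaging asked for in
HOME/LOCATED-GAP §cc-4 (W): `∃ polarized carrier with zeros-as-eigenvalues ⟺ WeilPositivity`). -/
theorem exists_polarized_iff_weilPositivity :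
    (∃ (θ : End ℂ (MIndex →₀ ℂ)) (B : (MIndex →₀ ℂ) →ₗ[ℂ] (MIndex →₀ ℂ) →ₗ⋆[ℂ] ℂ),
        ZerosAreEigenvalues θ ∧ Polarized θ B) ↔ WeilPositivity :=
  located_objects_tfae.out 4 1

/-- Real-structure reading ⟷ surface reading: the canonical form `B_τ` of the real twist is positive
definite iff a Weil surface over `ℝ³` exists. -/
theorem posDef_realForm_iff_nonempty_weilSurface :
    PosDef (mform partner sgn conjIdx sgn) ↔ Nonempty (WeilSurface (ℝ × ℝ × ℝ)) :=
  located_objects_tfae.out 5 2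

end Summit.RiemannHypothesis.RiemannHypothesis.Theorems.MotivicDoor.TwoCarriers
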